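import Mathlib
import HarnessLib
import Summits.Ventures.LatticeQCDFlow.Scaling.LocalDeterminant

/-!
# LatticeQCDFlow / Scaling — LOCAL DETERMINANT RATIOS, companion file: DECOUPLING of two distant
# supported perturbations (abstract engine, continued)

HONEST FRAMING: exact (Metropolis-corrected) sampling algorithms for lattice gauge theory;
figures of merit are autocorrelation/cost numbers at stated couplings and volumes; no
continuum-physics claim.

THEORY-2.md §3.4 / §4 C5 / §5.4 `FermionDeterminantCost` (v4.4, theory seat GEN-25, item 117a).  This
is the second half of theory2's `LocalDeterminant.lean`, split off at landing (custody lean-1 GEN-7,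
LEAD LINE 168) ONLY for the tree's 400-line limit — statements and proofs are theory2's, byte for
byte; the first half (`Scaling/LocalDeterminant.lean`) holds the Leibniz bounds, the Sylvester
compression `det (1 + K) = det (1 + K|_{s×s})`, the two-perturbation identity `det_add_add_mul_det`
and the one-perturbation laws `norm_det_add_le` / `abs_log_norm_det_add_sub_le`.  Here:

* `factorial_add_mul_mono`: the constant `(n! + n)·δ·(1 + δ)ⁿ⁻¹` is monotone in the support size;
* `norm_det_ratio_sub_one_le` — the DECOUPLING bound: with `E₁` supported in `s₁ × s₁`, `E₂` in
  `s₂ × s₂`, entries `≤ e`, entries of `(D + E₂)⁻¹` bounded by `a` and the CROSS entries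
  `(D + E₁)⁻¹ k l`, `k ∈ s₁`, `l ∈ s₂`, bounded by `b`, every `δ ≥ #s₁·#s₂²·e²·a·b` gives
  `‖det(D+E₁+E₂)·det D / (det(D+E₁)·det(D+E₂)) - 1‖ ≤ (#s₁! + #s₁)·δ·(1 + δ)^{#s₁ - 1}` — the
  connected two-perturbation ratio is as close to `1` as the cross block of the inverse is small;
  the quantitative form of "the logarithm of the fermion determinant … is non-local"
  [cite: MontvayMunster1994, §7.4 (7.139)–(7.141)].  All constants depend on the support sizes and
  the entry bounds only — never on `Fintype.card ι`.

The lattice instance is `Scaling/HeavyQuarkLocality.lean`.  NEW WORK of the cell; nothing is cited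
as a fact.
-/

noncomputable section

namespace Summit.Ventures.LatticeQCDFlow.Scaling.LocalDet

open Matrix Finset

variable {ι : Type*} [Fintype ι] [DecidableEq ι]

/-- The constant `(n! + n)·δ·(1 + δ)ⁿ⁻¹` is monotone in the support size `n`. [folklore] -/
theorem factorial_add_mul_mono {n n' : ℕ} (hn : n ≤ n') {δ : ℝ} (hδ : 0 ≤ δ) :
    ((n.factorial : ℝ) + n) * δ * (1 + δ) ^ (n - 1) ≤ (n'.factorial + n') * δ * (1 + δ) ^ (n' - 1) := by
  have h1 : (n.factorial : ℝ) + n ≤ n'.factorial + n' := by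
    exact_mod_cast Nat.add_le_add (Nat.factorial_le hn) hn
  have h2 : (1 + δ) ^ (n - 1) ≤ (1 + δ) ^ (n' - 1) :=
    pow_le_pow_right₀ (by linarith) (Nat.sub_le_sub_right hn 1)
  have h3 : (0 : ℝ) ≤ (n.factorial : ℝ) + n := by positivity
  calc ((n.factorial : ℝ) + n) * δ * (1 + δ) ^ (n - 1)
      ≤ ((n.factorial : ℝ) + n) * δ * (1 + δ) ^ (n' - 1) :=
        mul_le_mul_of_nonneg_left h2 (mul_nonneg h3 hδ)
    _ ≤ (n'.factorial + n') * δ * (1 + δ) ^ (n' - 1) := by gcongr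

/-- **Decoupling of two supported perturbations**: with `E₁` supported in `s₁ × s₁`, `E₂` in
`s₂ × s₂`, entries `≤ e`, entries of `(D + E₂)⁻¹` bounded by `a` and the CROSS entries
`(D + E₁)⁻¹ k l`, `k ∈ s₁`, `l ∈ s₂`, bounded by `b`, every `δ ≥ #s₁·#s₂²·e²·a·b` gives
`‖det(D+E₁+E₂)·det D / (det(D+E₁)·det(D+E₂)) - 1‖ ≤ (#s₁! + #s₁)·δ·(1 + δ)^{#s₁ - 1}`: the connected
two-perturbation ratio is as close to `1` as the cross block of the inverse is small. [folklore] -/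
theorem norm_det_ratio_sub_one_le (D E₁ E₂ : Matrix ι ι ℂ) (s₁ s₂ : Finset ι) {a b e δ : ℝ}
    (ha0 : 0 ≤ a) (hb0 : 0 ≤ b) (he0 : 0 ≤ e)
    (h₁ : IsUnit (D + E₁).det) (h₂ : IsUnit (D + E₂).det)
    (hE₁ : ∀ i j, E₁ i j ≠ 0 → i ∈ s₁ ∧ j ∈ s₁) (hE₂ : ∀ i j, E₂ i j ≠ 0 → i ∈ s₂ ∧ j ∈ s₂)
    (he₁ : ∀ i j, ‖E₁ i j‖ ≤ e) (he₂ : ∀ i j, ‖E₂ i j‖ ≤ e)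
    (ha : ∀ i j, ‖(D + E₂)⁻¹ i j‖ ≤ a) (hb : ∀ k ∈ s₁, ∀ l ∈ s₂, ‖(D + E₁)⁻¹ k l‖ ≤ b)
    (hδ : (s₁.card : ℝ) * s₂.card ^ 2 * e ^ 2 * a * b ≤ δ) :
    ‖(D + E₁ + E₂).det * D.det / ((D + E₁).det * (D + E₂).det) - 1‖ ≤
      ((s₁.card.factorial : ℝ) + s₁.card) * δ * (1 + δ) ^ (s₁.card - 1) := by
  set X := E₁ * (D + E₁)⁻¹ * E₂ * (D + E₂)⁻¹ with hXdef
  have hne : (D + E₁).det * (D + E₂).det ≠ 0 := mul_ne_zero h₁.ne_zero h₂.ne_zero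
  have hratio : (D + E₁ + E₂).det * D.det / ((D + E₁).det * (D + E₂).det) = (1 + (-X)).det := by
    rw [det_add_add_mul_det D E₁ E₂ h₁ h₂, mul_div_cancel_left₀ _ hne, ← sub_eq_add_neg]
  rw [hratio]
  -- rows of `X` (hence of `-X`) vanish outside `s₁`
  have hrow : ∀ i j, i ∉ s₁ → (-X) i j = 0 := by
    intro i j hi
    rw [Matrix.neg_apply, neg_eq_zero, hXdef, Matrix.mul_assoc, Matrix.mul_assoc, Matrix.mul_apply]
    refine Finset.sum_eq_zero fun k _ => ?_
    by_cases h0 : E₁ i k = 0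
    · rw [h0, zero_mul]
    · exact absurd (hE₁ i k h0).1 hi
  rw [det_one_add_eq_of_row_support _ s₁ hrow]
  -- entry bound of the compressed block
  have hδ0 : 0 ≤ (s₁.card : ℝ) * s₂.card ^ 2 * e ^ 2 * a * b := by positivity
  have hin : ∀ (i : ι) (l : ι), l ∈ s₂ → ‖(E₁ * (D + E₁)⁻¹) i l‖ ≤ s₁.card * (e * b) := by
    intro i l hl
    rw [Matrix.mul_apply]
    refine norm_sum_le_card_mul_of_support s₁ (fun k hk => ?_) fun k hk => ?_
    · by_cases h0 : E₁ i k = 0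
      · rw [h0, zero_mul]
      · exact absurd (hE₁ i k h0).2 hk
    · rw [norm_mul]; exact mul_le_mul (he₁ _ _) (hb k hk l hl) (norm_nonneg _) he0
  have hmid : ∀ (i : ι) (l' : ι),
      ‖(E₁ * (D + E₁)⁻¹ * E₂) i l'‖ ≤ s₂.card * (s₁.card * (e * b) * e) := by
    intro i l'
    rw [Matrix.mul_apply]
    refine norm_sum_le_card_mul_of_support s₂ (fun l hl => ?_) fun l hl => ?_
    · by_cases h0 : E₂ l l' = 0
      · rw [h0, mul_zero]
      · exact absurd (hE₂ l l' h0).1 hl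
    · rw [norm_mul]
      exact mul_le_mul (hin i l hl) (he₂ _ _) (norm_nonneg _) (by positivity)
  have hmid0 : ∀ (i : ι) (l' : ι), l' ∉ s₂ → (E₁ * (D + E₁)⁻¹ * E₂) i l' = 0 := by
    intro i l' hl'
    rw [Matrix.mul_apply]
    refine Finset.sum_eq_zero fun l _ => ?_
    by_cases h0 : E₂ l l' = 0
    · rw [h0, mul_zero]
    · exact absurd (hE₂ l l' h0).2 hl'
  have hX : ∀ i j, ‖X i j‖ ≤ δ := by
    intro i j
    rw [hXdef, Matrix.mul_apply]
    refine (norm_sum_le_card_mul_of_support s₂ (b := s₂.card * (s₁.card * (e * b) * e) * a)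
      (fun l' hl' => ?_) fun l' _ => ?_).trans ?_
    · rw [hmid0 i l' hl', zero_mul]
    · rw [norm_mul]
      exact mul_le_mul (hmid i l') (ha _ _) (norm_nonneg _) (by positivity)
    · refine le_trans (le_of_eq ?_) hδ
      ring
  have hent : ∀ i j : s₁, ‖((-X).submatrix Subtype.val Subtype.val) i j‖ ≤ δ := fun i j => by
    rw [Matrix.submatrix_apply, Matrix.neg_apply, norm_neg]; exact hX _ _
  refine (norm_det_one_add_sub_one_le _ (hδ0.trans hδ) hent).trans_eq ?_
  rw [Fintype.card_coe]

end Summit.Ventures.LatticeQCDFlow.Scaling.LocalDet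

end
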